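import Summits.QuantumAdvantage.AdviceFreeQNC0.HardcoreCylinder
import HarnessLib

/-!
# Cell qa-qnc0 — the TOGGLE LEMMA for the law of the kernel line (planner qa-qnc0-p1 g19, ROUND-18 §3.6
step (2); `exp19/Sketch19.lean` §6, def `HardcoreToggle` VERBATIM)

`hardcoreToggle_of : HardcoreCylinderLB → HardcoreToggle` and, with `hardcoreCylinderLB`
(`HardcoreCylinder.lean`), the unconditional `hardcoreToggle : HardcoreToggle`: for positions `p, p', u`
pairwise at cyclic distance `≥ 2` and any set `T ∋ u`, BOTH parities of `|supp J(x) ∩ T|` occur on at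
least `c₁·2^{n-1}` odd patterns `x` with particles at `p, p'` (`J = kline`).

Proof (planner's toggle, at the level of kernel lines): on the event
`E = {v hard-core : v_p = v_{p'} = 0, v_{u-1} = v_{u+1} = 1}` the toggle `v ↦ v ⊕ e_u` is an involution of
`E` (the neighbours of `u` are occupied, so hard-coreness is kept) which flips the `T`-parity (`u ∈ T`)
and changes the number of zeros by one, hence the fibre size `#{x odd : J(x) = v} = 2^{Z(v)-1}`
(`card_fibre`) by a factor `2`; so each parity class carries at least a third of the odd patterns over
`E`, and those number `≥ c₀·2^{n-1}` by the cylinder bound on `S = {p, p', u-1, u+1}`.  `c₁ = c₀/3`.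

WHAT THIS IS NOT: `AffineStakesHardOdd3` (steps (1), (3), (4)) is not proved here; crux 22907 untouched;
separation NOT moved.
-/

namespace Summit.QuantumAdvantage.AdviceFreeQNC0.Fib19

open Finset Literature.Computability.QuantumComplexity Literature.Computability.QuantumComplexity.RingHLF

variable {n : ℕ}

/-! ### Statement (Sketch19 §6, verbatim) -/

/-- Step (2), the TOGGLE LEMMA for the hard-core law (cylinder lower bound form): for positions
`p, p'` at cyclic distance ≥ 2 and a site `u` at distance ≥ 2 from both, and ANY set `T ∋ u`, both
parities of `|supp J(x) ∩ T|` occur on at least `c₁·2^{n-1}` odd patterns with particles at `p, p'`.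
(Toggle `J_u` on `{J_{u-1} = J_{u+1} = 1}` — realised on patterns by the creation move — changes the
fibre size by the factor 2 and flips the parity.)  `c₁` absolute.  (Sketch19 §6 `HardcoreToggle`, verbatim.) -/
def HardcoreToggle : Prop :=
  open scoped Classical in
  ∃ c₁ : ℝ, 0 < c₁ ∧ ∃ n₁ : ℕ, ∀ n ≥ n₁, ∀ p p' u : Fin n, ∀ T : Finset (Fin n),
    2 ≤ (p'.val + n - p.val) % n → 2 ≤ (p.val + n - p'.val) % n →
    2 ≤ (u.val + n - p.val) % n → 2 ≤ (p.val + n - u.val) % n →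
    2 ≤ (u.val + n - p'.val) % n → 2 ≤ (p'.val + n - u.val) % n → u ∈ T →
    ∀ b : ℕ, b < 2 →
      c₁ * (2 : ℝ) ^ (n - 1) ≤
        ((univ.filter fun x : Fin n → Bool => OddZeros x ∧ kline x p = false ∧ kline x p' = false ∧
          (T.filter fun k => kline x k = true).card % 2 = b).card : ℝ)

/-! ### Cyclic distance -/

/-- Cyclic distance `≥ 2` from `p` to `q` excludes `q = p + 1`. -/
theorem nxt_ne_of_two_le {p q : Fin n} (h : 2 ≤ (q.val + n - p.val) % n) : nxt p ≠ q := by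
  intro hq
  have hqv : q.val = (p.val + 1) % n := by rw [← hq]; rfl
  have hp := p.isLt
  by_cases hlt : p.val + 1 < n
  · rw [Nat.mod_eq_of_lt hlt] at hqv
    rw [hqv, show p.val + 1 + n - p.val = n + 1 from by omega, Nat.add_mod_left] at h
    exact absurd (Nat.mod_le 1 n) (by omega)
  · rw [show p.val + 1 = n from by omega, Nat.mod_self] at hqv
    rw [hqv, show 0 + n - p.val = 1 from by omega] at h
    exact absurd (Nat.mod_le 1 n) (by omega)

/-- Cyclic distance `≥ 2` from `p` to `q` excludes `q = p`. -/
theorem ne_of_two_le {p q : Fin n} (h : 2 ≤ (q.val + n - p.val) % n) : p ≠ q := by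
  rintro rfl
  rw [show p.val + n - p.val = n from by omega, Nat.mod_self] at h
  exact absurd h (by omega)

/-! ### Fibrewise counting and the one-site toggle -/

/-- Fibrewise count of odd patterns by their kernel line. -/
theorem card_filter_isOdd_eq_sum_fibre (P : (Fin n → Bool) → Prop) [DecidablePred P] :
    (univ.filter fun x : Fin n → Bool => IsOdd x ∧ P (kline x)).card =
      ∑ v ∈ univ.filter P, (univ.filter fun x : Fin n → Bool => IsOdd x ∧ kline x = v).card := by
  rw [card_eq_sum_card_fiberwise (f := kline) (t := univ.filter P)
    (by intro x hx; exact mem_filter.2 ⟨mem_univ _, (mem_filter.1 hx).2.2⟩)]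
  refine sum_congr rfl fun v hv => ?_
  congr 1
  ext x
  simp only [mem_filter, mem_univ, true_and]
  constructor
  · rintro ⟨⟨ho, -⟩, hk⟩; exact ⟨ho, hk⟩
  · rintro ⟨ho, hk⟩; exact ⟨⟨ho, hk.symm ▸ (mem_filter.1 hv).2⟩, hk⟩

/-- A flip loses at most `|S|` zeros. -/
theorem zeros_le_zeros_flipAt_add (v : Fin n → Bool) (S : Finset (Fin n)) :
    zeros v ≤ zeros (flipAt v S) + S.card := by
  unfold zeros
  calc _ ≤ ((univ.filter fun i : Fin n => flipAt v S i = false) ∪ S).card := by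
        refine card_le_card fun i hi => ?_
        rw [mem_filter] at hi
        rw [mem_union, mem_filter]
        by_cases h : i ∈ S
        · exact Or.inr h
        · exact Or.inl ⟨mem_univ _, by rw [flipAt_apply_of_not_mem h]; exact hi.2⟩
    _ ≤ _ := card_union_le _ _

/-- Toggling one site between two occupied neighbours keeps hard-coreness. -/
theorem hardCore_flipAt_singleton (hn : 2 ≤ n) (v : Fin n → Bool) (hv : HardCore v) (u : Fin n)
    (h1 : v (prv u) = true) (h2 : v (nxt u) = true) : HardCore (flipAt v {u}) := by
  have hnu : nxt u ≠ u := nxt_iterate_ne_self u (j := 1) Nat.one_pos (by omega)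
  have hpu : prv u ≠ u := fun h => hnu (by have h' := congrArg nxt h; rw [nxt_prv] at h'; exact h'.symm)
  constructor
  · rintro i ⟨hi0, hi1⟩
    by_cases hiu : i = u
    · rw [hiu, flipAt_apply_of_not_mem (show nxt u ∉ ({u} : Finset (Fin n)) by simp [hnu]), h2] at hi1
      exact Bool.noConfusion hi1
    by_cases hin : nxt i = u
    · have : i = prv u := by rw [← hin, prv_nxt]
      rw [this, flipAt_apply_of_not_mem (show prv u ∉ ({u} : Finset (Fin n)) by simp [hpu]), h1] at hi0
      exact Bool.noConfusion hi0
    · rw [flipAt_apply_of_not_mem (show i ∉ ({u} : Finset (Fin n)) by simp [hiu])] at hi0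
      rw [flipAt_apply_of_not_mem (show nxt i ∉ ({u} : Finset (Fin n)) by simp [hin])] at hi1
      exact hv.1 i ⟨hi0, hi1⟩
  · exact ⟨prv u, by rw [flipAt_apply_of_not_mem (show prv u ∉ ({u} : Finset (Fin n)) by simp [hpu]), h1]⟩

/-! ### The theorem -/

/-- **The toggle lemma follows from the cylinder bound** (`c₁ = c₀/3`). -/
theorem hardcoreToggle_of (hC : HardcoreCylinderLB) : HardcoreToggle := by
  classical
  obtain ⟨c₀, hc₀, n₁, hcyl⟩ := hC
  refine ⟨c₀ / 3, by positivity, max n₁ 3, fun n hn p p' u T h1 h2 h3 h4 h5 h6 huT b hb => ?_⟩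
  have hn₁ : n₁ ≤ n := le_trans (le_max_left _ _) hn
  have hn3 : 3 ≤ n := le_trans (le_max_right _ _) hn
  -- distinctness from the distance hypotheses
  have dpp' : nxt p ≠ p' := nxt_ne_of_two_le h1
  have dp'p : nxt p' ≠ p := nxt_ne_of_two_le h2
  have dpu : nxt p ≠ u := nxt_ne_of_two_le h3
  have dup : nxt u ≠ p := nxt_ne_of_two_le h4
  have dp'u : nxt p' ≠ u := nxt_ne_of_two_le h5
  have dup' : nxt u ≠ p' := nxt_ne_of_two_le h6
  have epu : p ≠ u := ne_of_two_le h3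
  have ep'u : p' ≠ u := ne_of_two_le h5
  have hpp : nxt p ≠ p := nxt_iterate_ne_self p (j := 1) Nat.one_pos (by omega)
  have hp'p' : nxt p' ≠ p' := nxt_iterate_ne_self p' (j := 1) Nat.one_pos (by omega)
  have hnu : nxt u ≠ u := nxt_iterate_ne_self u (j := 1) Nat.one_pos (by omega)
  have hpu : prv u ≠ u := fun h => hnu (by have h' := congrArg nxt h; rw [nxt_prv] at h'; exact h'.symm)
  have e1 : prv u ≠ p := fun h => dpu (by rw [← h, nxt_prv])
  have e2 : prv u ≠ p' := fun h => dp'u (by rw [← h, nxt_prv])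
  -- the events, by parity class
  set parT : (Fin n → Bool) → ℕ := fun v => (T.filter fun k => v k = true).card % 2 with hparT
  set E : ℕ → (Fin n → Bool) → Prop := fun b v => HardCore v ∧ v p = false ∧ v p' = false ∧
    v (prv u) = true ∧ v (nxt u) = true ∧ parT v = b with hE
  set fib : (Fin n → Bool) → Finset (Fin n → Bool) :=
    fun v => univ.filter fun x : Fin n → Bool => IsOdd x ∧ kline x = v with hfib
  set X : ℕ → Finset (Fin n → Bool) := fun b => univ.filter fun x : Fin n → Bool => IsOdd x ∧ E b (kline x)
    with hX
  -- the toggle `v ↦ v ⊕ e_u`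
  set t : (Fin n → Bool) → (Fin n → Bool) := fun v => flipAt v {u} with ht
  have ht_par : ∀ v, (parT (t v) + parT v) % 2 = 1 := by
    intro v
    have h := card_filter_flipAt_add_mod_two v T {u} true
    rw [show T ∩ {u} = {u} from inter_singleton_of_mem huT, card_singleton] at h
    simp only [hparT, ht]
    omega
  have ht_mem : ∀ b c : ℕ, b < 2 → c < 2 → b ≠ c → ∀ v, E b v → E c (t v) := by
    intro b c hb hc hbc v hv
    simp only [hE] at hv ⊢
    obtain ⟨hvc, hvp, hvp', hv1, hv2, hvpar⟩ := hv
    refine ⟨hardCore_flipAt_singleton (by omega) v hvc u hv1 hv2, ?_, ?_, ?_, ?_, ?_⟩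
    · rw [ht]; simp only; rw [flipAt_apply_of_not_mem (show p ∉ ({u} : Finset (Fin n)) by simp [epu]), hvp]
    · rw [ht]; simp only; rw [flipAt_apply_of_not_mem (show p' ∉ ({u} : Finset (Fin n)) by simp [ep'u]), hvp']
    · rw [ht]; simp only; rw [flipAt_apply_of_not_mem (show prv u ∉ ({u} : Finset (Fin n)) by simp [hpu]), hv1]
    · rw [ht]; simp only; rw [flipAt_apply_of_not_mem (show nxt u ∉ ({u} : Finset (Fin n)) by simp [hnu]), hv2]
    · have h := ht_par v
      have hlt : parT (t v) < 2 := Nat.mod_lt _ two_pos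
      rw [hvpar] at h
      omega
  have ht_inv : ∀ v, t (t v) = v := fun v => flipAt_flipAt v {u}
  -- mass comparison between the two parity classes
  have hmass : ∀ b c : ℕ, b < 2 → c < 2 → b ≠ c → (X b).card ≤ 2 * (X c).card := by
    intro b c hb hc hbc
    have hXb : (X b).card = ∑ v ∈ univ.filter (E b), (fib v).card := card_filter_isOdd_eq_sum_fibre (E b)
    have hXc : (X c).card = ∑ v ∈ univ.filter (E c), (fib v).card := card_filter_isOdd_eq_sum_fibre (E c)
    rw [hXb, hXc]
    calc ∑ v ∈ univ.filter (E b), (fib v).card ≤ ∑ v ∈ univ.filter (E b), 2 * (fib (t v)).card := by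
          refine sum_le_sum fun v hv => ?_
          have hv' := (mem_filter.1 hv).2
          have htv := ht_mem b c hb hc hbc v hv'
          simp only [hE] at hv' htv
          have hz : 0 < zeros v := card_pos.2 ⟨p, mem_filter.2 ⟨mem_univ _, hv'.2.1⟩⟩
          have hz' : 0 < zeros (t v) := card_pos.2 ⟨p, mem_filter.2 ⟨mem_univ _, htv.2.1⟩⟩
          simp only [hfib]
          rw [card_fibre hn3 v hv'.1 hz, card_fibre hn3 (t v) htv.1 hz', ← pow_succ']
          apply Nat.pow_le_pow_right two_pos
          have hzz := zeros_le_zeros_flipAt_add v {u}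
          rw [card_singleton] at hzz
          simp only [ht]
          omega
      _ = 2 * ∑ v ∈ univ.filter (E b), (fib (t v)).card := by rw [mul_sum]
      _ = 2 * ∑ v ∈ univ.filter (E c), (fib v).card := by
          congr 1
          refine sum_nbij' t t (fun v hv => ?_) (fun v hv => ?_) (fun v _ => ht_inv v) (fun v _ => ht_inv v)
            (fun v _ => rfl)
          · exact mem_filter.2 ⟨mem_univ _, ht_mem b c hb hc hbc v (mem_filter.1 hv).2⟩
          · exact mem_filter.2 ⟨mem_univ _, ht_mem c b hc hb (Ne.symm hbc) v (mem_filter.1 hv).2⟩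
  -- the whole event has mass ≥ c₀·2^{n-1} (cylinder bound on `{p, p', u-1, u+1}`)
  set σ : Fin n → Bool := fun i => if i = p ∨ i = p' then false else true with hσ
  have hS : ({p, p', prv u, nxt u} : Finset (Fin n)).card ≤ 7 := card_le_four.trans (by norm_num)
  have hσS : ∀ i ∈ ({p, p', prv u, nxt u} : Finset (Fin n)), nxt i ∈ ({p, p', prv u, nxt u} : Finset (Fin n)) →
      ¬ (σ i = false ∧ σ (nxt i) = false) := by
    rintro i - - ⟨hi, hni⟩
    have hz : ∀ j, σ j = false → j = p ∨ j = p' := by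
      intro j hj; by_contra hne; simp only [hσ, hne, if_false] at hj; exact Bool.noConfusion hj
    rcases hz i hi with rfl | rfl
    · rcases hz _ hni with h | h
      · exact hpp h
      · exact dpp' h
    · rcases hz _ hni with h | h
      · exact dp'p h
      · exact hp'p' h
  have hcyl' := hcyl n hn₁ {p, p', prv u, nxt u} hS σ hσS
  have htotal : c₀ * (2 : ℝ) ^ (n - 1) ≤ ((X 0).card + (X 1).card : ℝ) := by
    refine le_trans hcyl' ?_
    have hsub : (univ.filter fun x : Fin n → Bool => OddZeros x ∧
        ∀ i ∈ ({p, p', prv u, nxt u} : Finset (Fin n)), kline x i = σ i) ⊆ X 0 ∪ X 1 := by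
      intro x hx
      rw [mem_filter] at hx
      obtain ⟨-, ho, hk⟩ := hx
      rw [← isOdd_iff_oddZeros] at ho
      have hkp : kline x p = false := by rw [hk p (by simp)]; simp [hσ]
      have hkp' : kline x p' = false := by rw [hk p' (by simp)]; simp [hσ]
      have hk1 : kline x (prv u) = true := by rw [hk (prv u) (by simp)]; simp [hσ, e1, e2]
      have hk2 : kline x (nxt u) = true := by rw [hk (nxt u) (by simp)]; simp [hσ, dup, dup']
      have hpar : parT (kline x) < 2 := Nat.mod_lt _ two_pos
      rw [mem_union]
      simp only [hX, hE, mem_filter, mem_univ, true_and]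
      rcases Nat.lt_succ_iff.1 hpar |>.eq_or_lt with h | h
      · exact Or.inr ⟨ho, kline_hardCore hn3 x ho, hkp, hkp', hk1, hk2, h⟩
      · exact Or.inl ⟨ho, kline_hardCore hn3 x ho, hkp, hkp', hk1, hk2, by omega⟩
    have := le_trans (card_le_card hsub) (card_union_le _ _)
    exact_mod_cast this
  -- the target contains `X b`
  have hXsub : (X b).card ≤ (univ.filter fun x : Fin n → Bool => OddZeros x ∧ kline x p = false ∧
      kline x p' = false ∧ (T.filter fun k => kline x k = true).card % 2 = b).card := by
    refine card_le_card fun x hx => ?_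
    simp only [hX, hE, mem_filter, mem_univ, true_and] at hx
    rw [mem_filter]
    exact ⟨mem_univ _, (isOdd_iff_oddZeros x).1 hx.1, hx.2.2.1, hx.2.2.2.1, hx.2.2.2.2.2.2⟩
  have hthird : c₀ * (2 : ℝ) ^ (n - 1) ≤ 3 * ((X b).card : ℝ) := by
    refine le_trans htotal ?_
    have hb' : b = 0 ∨ b = 1 := by omega
    rcases hb' with rfl | rfl
    · have := hmass 1 0 (by norm_num) (by norm_num) (by norm_num)
      have : ((X 1).card : ℝ) ≤ 2 * ((X 0).card : ℝ) := by exact_mod_cast this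
      linarith
    · have := hmass 0 1 (by norm_num) (by norm_num) (by norm_num)
      have : ((X 0).card : ℝ) ≤ 2 * ((X 1).card : ℝ) := by exact_mod_cast this
      linarith
  have hXr : ((X b).card : ℝ) ≤ _ := Nat.cast_le.2 hXsub
  linarith

/-- **The toggle lemma, unconditionally** (`hardcoreCylinderLB`). -/
theorem hardcoreToggle : HardcoreToggle := hardcoreToggle_of hardcoreCylinderLB

end Summit.QuantumAdvantage.AdviceFreeQNC0.Fib19
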